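import Literature.AlgebraicGeometry.Motives.IntegralModelTwoSectionPushforward
import Literature.AlgebraicGeometry.Motives.IntegralModelFibreCountEtale
import Literature.AlgebraicGeometry.Motives.IntegralModelEtaleNearOfSpecialFibre
import Literature.AlgebraicGeometry.Motives.AlgPointsFibreCardOfFiniteEtale
import Literature.AlgebraicGeometry.Motives.AlgPointsMapSurjectiveAlgClosed
import Literature.NumberTheory.DiophantineGeometry.AVIsogenyTateProofs
import HarnessLib

/-!
# The generic two-section bridge as ONE theorem: «special fibre = two sections, `π₁ᵥ` an open immersion off the crossing ⇒
# pushforward multiset `{π₂ᵥ (s x̄)} + (n − 1) • {π₂ᵥ (s' x̄)}`» ([SerreTate1968] §1; [EGAIV4] 17.6.1, 18.5.17; [Liu2021] proof of Cor. D.9)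

`Literature/AlgebraicGeometry/Motives/IntegralModelTwoSectionFibreIdentity.lean`, namespace
`Literature.AlgebraicGeometry.Motives` (`AlgPoints`, `IntegralModel`).  THEOREMS only (no definition, no instance, no notation, no named
fact, no `sorry`).  Cell `hodgecm-mathlib` (D-0151), FLOOR 0, programme F0P5a (D9op road 2′, crux item stmt-HodgeConjecture-24832, socket
`stub_C3`; line ED. 4 unchanged).  The (γ3-GENERIC) rows of the F0P5a desk `Gamma3-DESK.v0.3` are ★ one by one —
(Γ3-A) ★ `IntegralModel.finsum_geomReductionMap_map_eq_of_two_sections`, (Γ3-E1) ★ `IntegralModel.ncard_fibre_geomReductionMap_eq_one_of_etale`,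
(Γ3-E1a) ★ `IntegralModel.exists_etale_of_isOpenImmersion_specialFibre`, (Γ3-D) ★ `AlgPoints.card_fibre_eq_finrank_of_isFinite_of_etale` —;
this file COMPOSES them into the single socket the record bridge consumes, with the three auxiliary hypotheses of (Γ3-A) DISCHARGED:

* `hone` (multiplicity one on the `s`-branch) from «`π₁` flat + locally finitely presented, `s` a section of `π₁ᵥ`, and `π₁ᵥ` an OPEN IMMERSION
  on an open `V ∋ s ȳ` whenever `s ȳ ≠ s' ȳ`» — (Γ3-E1a) then (Γ3-E1) at `z := s x̄`
  (§3 `ncard_fibre_geomReductionMap_eq_one_of_isOpenImmersion_specialFibre`, §4 head);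
* `hfin` (finite fibres of `p₁` on `Ω`-points) from `IsFinite p₁.left` (§1 `AlgPoints.finite_fibre_of_isFinite`, any field `Ω`), or from
  `IsFinite π₁.left` on the MODEL morphism (§2: a base-change-stable property of `π.left` passes to the generic fibre `p.left`);
* `hne` (non-empty fibres) from `Surjective p₁.left` (★ `AlgPoints.map_surjective_of_surjective_of_isAlgClosed`), or from `Surjective π₁.left`.

DATA (tree D1 currency ★ `IntegralModel.geomReductionMap`, ★ C2a `geomReductionMap_map`): a number field `K`, a finite place `v`,
`Ω = \overline{K_v}`, PROPER integral models `𝒮`, `𝒯` of `X`, `T` over `𝓞_{K,(v)}`, model morphisms `π₁ π₂ : 𝒯 ⟶ 𝒮` with generic fibres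
`p₁ p₂ : T ⟶ X` (C2a squares `hπ₁`, `hπ₂`), two maps `s s'` on `κ̄(v)`-points of the special fibres whose values exhaust the `π₁ᵥ`-fibres
(`hcov`), `s` a section of `π₁ᵥ` (`hs`), an open `V ⊆ 𝒯ᵥ` with `π₁ᵥ|_V` an open immersion and `s ȳ ∈ V` whenever `s ȳ ≠ s' ȳ` (`hV`).
These are — binder for binder — the currency-free clauses of the record desk letter `RecordCurveCongruenceCorrespondence` (F0P5a-plan (g2)
`Gamma3-RECORD-DESK.v0` :51; [Liu2021] Prop. D.8 (1)–(3): `V = T⁺ ∖ T⁻`, `π₁ᵥ|_{T⁺}` an isomorphism, `s = ` the `T⁺`-branch, `s' = ` the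
`T⁻`-branch); NOTHING of that record currency (Shimura datum, Hecke translates, Frobenius, `⟨ϖ⟩`) is used or asserted here.

* §1 `AlgPoints.finite_fibre_of_isFinite` — a FINITE `p : T ⟶ X` over a field `k` has finitely many `Ω`-points over every `Ω`-point (any field
  `Ω ⊇ k`; ★ `DiophantineGeometry.finite_specHom_comp_eq_of_isFinite` through ★ `AlgPoints.bijective_left_fibre`).
* §2 `IntegralModel.left_of_genericFibre` — for a morphism property `P` stable under base change, `P π.left ⇒ P p.left` whenever `p` is the
  generic fibre of the model morphism `π` (C2a square); instances `isFinite_of_genericFibre`, `surjective_of_genericFibre`, `etale_of_genericFibre`.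
* §3 `IntegralModel.ncard_fibre_geomReductionMap_eq_one_of_isOpenImmersion_specialFibre` — (Γ3-E1a) ∘ (Γ3-E1): for `π` flat, lfp, with
  `πᵥ|_V` an open immersion and `z ∈ V` over `red_𝒮 x`, EXACTLY ONE `y ∈ T(Ω)` over `x` reduces to `z`.
* §4 **`IntegralModel.finsum_geomReductionMap_map_eq_of_isOpenImmersion_specialFibre`** (the bridge; `hfin`, `hne` explicit) and its forms
  `…_of_isFinite` (`[IsFinite p₁.left] [Surjective p₁.left]`), `…_of_isFinite_left` (`[IsFinite π₁.left] [Surjective π₁.left]`, all hypotheses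
  on the MODEL morphism), `…_of_etale` (`p₁.left` finite étale — a neat level —: `n = p₁.left.finrank` at the point of `x`, (Γ3-D)).

HC_CM is proved only modulo the 7 printed citations until rung 0 closes; this file is generic capital and changes no count.  Ours
(formalisation glue); axioms `propext`, `Classical.choice`, `Quot.sound`.

## References
* [SerreTate1968] J.-P. Serre, J. Tate, *Good reduction of abelian varieties*, Ann. of Math. 88 (1968), §1 (the reduction map).
* [EGAIV4] A. Grothendieck, J. Dieudonné, *ÉGA IV₄*, Publ. Math. IHÉS 32 (1967), Thm. 17.6.1, Thm. 18.5.17.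
* [GortzWedhorn2020] U. Görtz, T. Wedhorn, *Algebraic Geometry I* (2nd ed.), (4.7.1) p. 108, Prop. 12.11, Prop. 12.21.
* [StacksProject] The Stacks Project, Tags 02GU, 04GG, 01WL (finite morphisms are stable under base change).
* [Liu2021] Y. Liu, proof of Cor. D.9, p. 139 L4–L10 (where `n = q + 1` and the two sections are `T⁺`, `T⁻`).
-/

set_option autoImplicit false

noncomputable section

open CategoryTheory CategoryTheory.Limits AlgebraicGeometry IsDedekindDomain IsDedekindDomain.HeightOneSpectrum IsLocalRing
open scoped NumberField
open Literature.NumberTheory.EllipticCurves (genericFibre)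
open Literature.NumberTheory.GaloisRepresentations (closureValuationSubring)
open Literature.NumberTheory.DiophantineGeometry

universe u

namespace Literature.AlgebraicGeometry.Motives

/-! ### §1 Finite morphisms have finite geometric fibres (`AlgPoints` currency) -/

namespace AlgPoints

variable {k : Type u} [Field k] {Ω : Type u} [Field Ω] [Algebra k Ω] {X T : SchemeOver k}

/-- **A finite morphism has finitely many `Ω`-points over every `Ω`-point**: for `p : T ⟶ X` over `k` with `p.left` finite and ANY field
`Ω ⊇ k`, `{y : T(Ω) // p y = x}` is finite (★ `finite_specHom_comp_eq_of_isFinite`: the fibre `T ×_X Spec Ω` is the spectrum of a finite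
`Ω`-algebra, which has finitely many `Ω`-points; transported along ★ `bijective_left_fibre`).
[cite: GortzWedhorn2020, Prop. 12.11] [cite: GortzWedhorn2020, Section (4.7), (4.7.1) (p. 108)] -/
theorem finite_fibre_of_isFinite (p : T ⟶ X) [IsFinite p.left] (x : AlgPoints X Ω) :
    Finite {y : AlgPoints T Ω // AlgPoints.map p y = x} := by
  haveI := finite_specHom_comp_eq_of_isFinite p.left inferInstance x.left
  exact Finite.of_injective _ (bijective_left_fibre p x).1

/-- `Set.Finite` form of `finite_fibre_of_isFinite`. [cite: GortzWedhorn2020, Prop. 12.11] -/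
theorem setOf_map_eq_finite_of_isFinite (p : T ⟶ X) [IsFinite p.left] (x : AlgPoints X Ω) :
    Set.Finite {y : AlgPoints T Ω | AlgPoints.map p y = x} :=
  Set.finite_coe_iff.mp (finite_fibre_of_isFinite p x)

end AlgPoints

/-! ### §2 Base-change-stable properties pass from a model morphism to its generic fibre -/

namespace IntegralModel

variable {K : Type} [Field K] [NumberField K] {v : HeightOneSpectrum (𝓞 K)} {X T : SchemeOver K}

/-- **`P π.left ⇒ P p.left`** for a morphism property `P` stable under base change: if `π : 𝒯 ⟶ 𝒮` is a morphism of integral models at `v`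
whose generic fibre is `p : T ⟶ X` (C2a square `π_K ≫ e_𝒮 = e_𝒯 ≫ p`), then `p.left = e_𝒯⁻¹ ≫ (π_K).left ≫ e_𝒮` with `(π_K).left` a base
change of `π.left` along `Spec K → Spec 𝓞_{K,(v)}` (Mathlib `MorphismProperty.overPullbackMap`), and `P` respects the two isomorphisms.
[cite: StacksProject, Tag 01WL] [cite: SerreTate1968, §1] -/
theorem left_of_genericFibre (P : MorphismProperty Scheme.{0}) [P.IsStableUnderBaseChange]
    (𝒮 : IntegralModel (valuationSubringAtPrime K v) K X) (𝒯 : IntegralModel (valuationSubringAtPrime K v) K T)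
    (π : 𝒯.total ⟶ 𝒮.total) (p : T ⟶ X)
    (hπp : (genericFibre (valuationSubringAtPrime K v) K).map π ≫ 𝒮.genericIso'.hom = 𝒯.genericIso'.hom ≫ p) (h : P π.left) :
    P p.left := by
  have hp : p = 𝒯.genericIso'.inv ≫ (genericFibre (valuationSubringAtPrime K v) K).map π ≫ 𝒮.genericIso'.hom :=
    (Iso.eq_inv_comp _).mpr hπp.symm
  rw [hp, Over.comp_left, Over.comp_left, P.cancel_left_of_respectsIso, P.cancel_right_of_respectsIso]
  exact MorphismProperty.overPullbackMap _ π h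

/-- `IsFinite π.left ⇒ IsFinite p.left` (finite morphisms are stable under base change). [cite: StacksProject, Tag 01WL] -/
theorem isFinite_of_genericFibre (𝒮 : IntegralModel (valuationSubringAtPrime K v) K X)
    (𝒯 : IntegralModel (valuationSubringAtPrime K v) K T) (π : 𝒯.total ⟶ 𝒮.total) (p : T ⟶ X)
    (hπp : (genericFibre (valuationSubringAtPrime K v) K).map π ≫ 𝒮.genericIso'.hom = 𝒯.genericIso'.hom ≫ p) [IsFinite π.left] :
    IsFinite p.left :=
  left_of_genericFibre (P := @IsFinite) 𝒮 𝒯 π p hπp inferInstance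

/-- `Surjective π.left ⇒ Surjective p.left` (surjective morphisms are stable under base change). [cite: StacksProject, Tag 01S1] -/
theorem surjective_of_genericFibre (𝒮 : IntegralModel (valuationSubringAtPrime K v) K X)
    (𝒯 : IntegralModel (valuationSubringAtPrime K v) K T) (π : 𝒯.total ⟶ 𝒮.total) (p : T ⟶ X)
    (hπp : (genericFibre (valuationSubringAtPrime K v) K).map π ≫ 𝒮.genericIso'.hom = 𝒯.genericIso'.hom ≫ p) [Surjective π.left] :
    Surjective p.left :=
  left_of_genericFibre (P := @Surjective) 𝒮 𝒯 π p hπp inferInstance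

/-- `Etale π.left ⇒ Etale p.left` (étale morphisms are stable under base change). [cite: StacksProject, Tag 02GO] -/
theorem etale_of_genericFibre (𝒮 : IntegralModel (valuationSubringAtPrime K v) K X)
    (𝒯 : IntegralModel (valuationSubringAtPrime K v) K T) (π : 𝒯.total ⟶ 𝒮.total) (p : T ⟶ X)
    (hπp : (genericFibre (valuationSubringAtPrime K v) K).map π ≫ 𝒮.genericIso'.hom = 𝒯.genericIso'.hom ≫ p) [Etale π.left] :
    Etale p.left :=
  left_of_genericFibre (P := @Etale) 𝒮 𝒯 π p hπp inferInstance

/-! ### §3 (Γ3-E1a) ∘ (Γ3-E1): multiplicity one at a point where the special fibre is an open immersion -/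

/-- **Exactly one point of `T(Ω)` over `x` reduces to `z` when `πᵥ` is an open immersion near `z`.**  PROPER models `𝒮`, `𝒯`, a model
morphism `π : 𝒯 ⟶ 𝒮`, FLAT and locally of finite presentation, with generic fibre `p : T ⟶ X`; an open `V ⊆ 𝒯ᵥ` on which the special fibre
`πᵥ` is an open immersion; `x ∈ X(Ω)` and `z ∈ 𝒯ᵥ(κ̄(v))` over `red_𝒮 x` with underlying point in `V`.  Then `#{y ∈ T(Ω) | p y = x, red_𝒯 y = z} = 1`
(★ (Γ3-E1a) `exists_etale_of_isOpenImmersion_specialFibre`: `π` is étale on an open `U ∋ z`; ★ (Γ3-E1) `ncard_fibre_geomReductionMap_eq_one_of_etale`: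
henselian unique lifting through `U`).
[cite: EGAIV4, Thm. 17.6.1 and Thm. 18.5.17 (p. 134)] [cite: SerreTate1968, §1] [cite: StacksProject, Tag 02GU and Tag 04GG] -/
theorem ncard_fibre_geomReductionMap_eq_one_of_isOpenImmersion_specialFibre
    (𝒮 : IntegralModel (valuationSubringAtPrime K v) K X) (𝒯 : IntegralModel (valuationSubringAtPrime K v) K T)
    [IsProper 𝒮.total.hom] [IsProper 𝒯.total.hom]
    (π : 𝒯.total ⟶ 𝒮.total) [Flat π.left] [LocallyOfFinitePresentation π.left] (p : T ⟶ X)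
    (hπp : (genericFibre (valuationSubringAtPrime K v) K).map π ≫ 𝒮.genericIso'.hom = 𝒯.genericIso'.hom ≫ p)
    (V : (𝒯.reductionAt).left.Opens) [IsOpenImmersion (V.ι ≫ ((specialFibreFunctor v).map π).left)]
    (x : AlgPoints X (AlgebraicClosure (v.adicCompletion K))) (z : AlgPoints 𝒯.reductionAt (geomResidueField v))
    (hz : AlgPoints.map ((specialFibreFunctor v).map π) z = 𝒮.geomReductionMap x)
    (hzV : z.toSpecHom.base (closedPoint (geomResidueField v)) ∈ V) :
    Set.ncard {y : AlgPoints T (AlgebraicClosure (v.adicCompletion K)) | AlgPoints.map p y = x ∧ 𝒯.geomReductionMap y = z} = 1 := by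
  obtain ⟨U, hzU, hU⟩ := exists_etale_of_isOpenImmersion_specialFibre 𝒮 𝒯 π V z hzV
  haveI := hU
  exact ncard_fibre_geomReductionMap_eq_one_of_etale 𝒮 𝒯 π p hπp U x z hz hzU

/-! ### §4 The bridge: two-section special fibre with `π₁ᵥ` an open immersion off the crossing ⇒ the pushforward multiset -/

/-- **The generic two-section bridge.**  PROPER models `𝒮`, `𝒯` of `X`, `T` at `v`; model morphisms `π₁ π₂ : 𝒯 ⟶ 𝒮` with generic fibres
`p₁ p₂ : T ⟶ X`, `π₁` FLAT and locally of finite presentation; the `p₁`-fibres on `Ω`-points finite (`hfin`) and non-empty (`hne`); two maps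
`s s'` on `κ̄(v)`-points with values exhausting the `π₁ᵥ`-fibres (`hcov`), `s` a SECTION of `π₁ᵥ` (`hs`); an open `V ⊆ 𝒯ᵥ` on which `π₁ᵥ` is
an OPEN IMMERSION, containing `s ȳ` whenever `s ȳ ≠ s' ȳ` (`hV`).  Then for every `x ∈ X(Ω)`, `x̄ := red_𝒮 x`, `n := #p₁⁻¹(x)`:
`Σ_{y over x} {red_𝒮 (p₂ y)} = {π₂ᵥ (s x̄)} + (n − 1) • {π₂ᵥ (s' x̄)}`.
(★ (Γ3-A) `finsum_geomReductionMap_map_eq_of_two_sections` with its multiplicity-one hypothesis supplied by §3 at `z := s x̄`.)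
In [Liu2021] Prop. D.8: `V = T⁺ ∖ T⁻`, `s`/`s'` the `T⁺`/`T⁻`-branches, `n = q + 1`; none of that is used here.
[cite: SerreTate1968, §1] [cite: EGAIV4, Thm. 17.6.1 and Thm. 18.5.17 (p. 134)] [cite: Liu2021, proof of Cor. D.9 p. 139 L4–L10] -/
theorem finsum_geomReductionMap_map_eq_of_isOpenImmersion_specialFibre
    (𝒮 : IntegralModel (valuationSubringAtPrime K v) K X) (𝒯 : IntegralModel (valuationSubringAtPrime K v) K T)
    [IsProper 𝒮.total.hom] [IsProper 𝒯.total.hom]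
    (π₁ π₂ : 𝒯.total ⟶ 𝒮.total) [Flat π₁.left] [LocallyOfFinitePresentation π₁.left] (p₁ p₂ : T ⟶ X)
    (hπ₁ : (genericFibre (valuationSubringAtPrime K v) K).map π₁ ≫ 𝒮.genericIso'.hom = 𝒯.genericIso'.hom ≫ p₁)
    (hπ₂ : (genericFibre (valuationSubringAtPrime K v) K).map π₂ ≫ 𝒮.genericIso'.hom = 𝒯.genericIso'.hom ≫ p₂)
    (hfin : ∀ x : AlgPoints X (AlgebraicClosure (v.adicCompletion K)),
      Set.Finite {y : AlgPoints T (AlgebraicClosure (v.adicCompletion K)) | AlgPoints.map p₁ y = x})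
    (hne : ∀ x : AlgPoints X (AlgebraicClosure (v.adicCompletion K)),
      ∃ y : AlgPoints T (AlgebraicClosure (v.adicCompletion K)), AlgPoints.map p₁ y = x)
    (s s' : AlgPoints 𝒮.reductionAt (geomResidueField v) → AlgPoints 𝒯.reductionAt (geomResidueField v))
    (hcov : ∀ (z : AlgPoints 𝒯.reductionAt (geomResidueField v)) (yb : AlgPoints 𝒮.reductionAt (geomResidueField v)),
      AlgPoints.map ((specialFibreFunctor v).map π₁) z = yb → z = s yb ∨ z = s' yb)
    (hs : ∀ yb : AlgPoints 𝒮.reductionAt (geomResidueField v), AlgPoints.map ((specialFibreFunctor v).map π₁) (s yb) = yb)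
    (V : (𝒯.reductionAt).left.Opens) [IsOpenImmersion (V.ι ≫ ((specialFibreFunctor v).map π₁).left)]
    (hV : ∀ yb : AlgPoints 𝒮.reductionAt (geomResidueField v),
      s yb ≠ s' yb → (s yb).toSpecHom.base (closedPoint (geomResidueField v)) ∈ V)
    (x : AlgPoints X (AlgebraicClosure (v.adicCompletion K))) :
    ∑ᶠ y : {y : AlgPoints T (AlgebraicClosure (v.adicCompletion K)) // AlgPoints.map p₁ y = x},
        ({𝒮.geomReductionMap (AlgPoints.map p₂ y.1)} : Multiset (AlgPoints 𝒮.reductionAt (geomResidueField v)))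
      = {AlgPoints.map ((specialFibreFunctor v).map π₂) (s (𝒮.geomReductionMap x))}
        + (Nat.card {y : AlgPoints T (AlgebraicClosure (v.adicCompletion K)) // AlgPoints.map p₁ y = x} - 1) •
          ({AlgPoints.map ((specialFibreFunctor v).map π₂) (s' (𝒮.geomReductionMap x))} :
            Multiset (AlgPoints 𝒮.reductionAt (geomResidueField v))) :=
  finsum_geomReductionMap_map_eq_of_two_sections 𝒮 𝒯 π₁ π₂ p₁ p₂ hπ₁ hπ₂ hfin hne s s' hcov
    (fun x hss' => ncard_fibre_geomReductionMap_eq_one_of_isOpenImmersion_specialFibre 𝒮 𝒯 π₁ p₁ hπ₁ V x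
      (s (𝒮.geomReductionMap x)) (hs _) (hV _ hss')) x

/-- **The bridge with `p₁.left` FINITE and SURJECTIVE** (so the `p₁`-fibres on `Ω`-points are finite, §1, and non-empty, ★
`AlgPoints.map_surjective_of_surjective_of_isAlgClosed`); all other binders as in
`finsum_geomReductionMap_map_eq_of_isOpenImmersion_specialFibre`.
[cite: SerreTate1968, §1] [cite: EGAIV4, Thm. 17.6.1 and Thm. 18.5.17 (p. 134)] [cite: GortzWedhorn2020, Prop. 12.11] -/
theorem finsum_geomReductionMap_map_eq_of_isOpenImmersion_specialFibre_of_isFinite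
    (𝒮 : IntegralModel (valuationSubringAtPrime K v) K X) (𝒯 : IntegralModel (valuationSubringAtPrime K v) K T)
    [IsProper 𝒮.total.hom] [IsProper 𝒯.total.hom]
    (π₁ π₂ : 𝒯.total ⟶ 𝒮.total) [Flat π₁.left] [LocallyOfFinitePresentation π₁.left] (p₁ p₂ : T ⟶ X)
    [IsFinite p₁.left] [Surjective p₁.left]
    (hπ₁ : (genericFibre (valuationSubringAtPrime K v) K).map π₁ ≫ 𝒮.genericIso'.hom = 𝒯.genericIso'.hom ≫ p₁)
    (hπ₂ : (genericFibre (valuationSubringAtPrime K v) K).map π₂ ≫ 𝒮.genericIso'.hom = 𝒯.genericIso'.hom ≫ p₂)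
    (s s' : AlgPoints 𝒮.reductionAt (geomResidueField v) → AlgPoints 𝒯.reductionAt (geomResidueField v))
    (hcov : ∀ (z : AlgPoints 𝒯.reductionAt (geomResidueField v)) (yb : AlgPoints 𝒮.reductionAt (geomResidueField v)),
      AlgPoints.map ((specialFibreFunctor v).map π₁) z = yb → z = s yb ∨ z = s' yb)
    (hs : ∀ yb : AlgPoints 𝒮.reductionAt (geomResidueField v), AlgPoints.map ((specialFibreFunctor v).map π₁) (s yb) = yb)
    (V : (𝒯.reductionAt).left.Opens) [IsOpenImmersion (V.ι ≫ ((specialFibreFunctor v).map π₁).left)]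
    (hV : ∀ yb : AlgPoints 𝒮.reductionAt (geomResidueField v),
      s yb ≠ s' yb → (s yb).toSpecHom.base (closedPoint (geomResidueField v)) ∈ V)
    (x : AlgPoints X (AlgebraicClosure (v.adicCompletion K))) :
    ∑ᶠ y : {y : AlgPoints T (AlgebraicClosure (v.adicCompletion K)) // AlgPoints.map p₁ y = x},
        ({𝒮.geomReductionMap (AlgPoints.map p₂ y.1)} : Multiset (AlgPoints 𝒮.reductionAt (geomResidueField v)))
      = {AlgPoints.map ((specialFibreFunctor v).map π₂) (s (𝒮.geomReductionMap x))}
        + (Nat.card {y : AlgPoints T (AlgebraicClosure (v.adicCompletion K)) // AlgPoints.map p₁ y = x} - 1) •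
          ({AlgPoints.map ((specialFibreFunctor v).map π₂) (s' (𝒮.geomReductionMap x))} :
            Multiset (AlgPoints 𝒮.reductionAt (geomResidueField v))) :=
  finsum_geomReductionMap_map_eq_of_isOpenImmersion_specialFibre 𝒮 𝒯 π₁ π₂ p₁ p₂ hπ₁ hπ₂
    (fun x => AlgPoints.setOf_map_eq_finite_of_isFinite p₁ x)
    (fun x => AlgPoints.map_surjective_of_surjective_of_isAlgClosed p₁ x) s s' hcov hs V hV x

/-- **The bridge with every hypothesis on the MODEL morphism `π₁`**: `π₁.left` flat, locally finitely presented, FINITE and SURJECTIVE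
(§2 transfers finiteness and surjectivity to the generic fibre `p₁`).  This is the shape a modular integral model delivers
([Liu2021] Prop. D.8 (1): `π₁ : 𝒯 → 𝒮` finite flat, the Iwahori-level model over the hyperspecial one).
[cite: SerreTate1968, §1] [cite: EGAIV4, Thm. 17.6.1 and Thm. 18.5.17 (p. 134)] [cite: StacksProject, Tag 01WL]
[cite: Liu2021, Prop. D.8 (1)–(3) and proof of Cor. D.9 p. 139 L4–L10] -/
theorem finsum_geomReductionMap_map_eq_of_isOpenImmersion_specialFibre_of_isFinite_left
    (𝒮 : IntegralModel (valuationSubringAtPrime K v) K X) (𝒯 : IntegralModel (valuationSubringAtPrime K v) K T)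
    [IsProper 𝒮.total.hom] [IsProper 𝒯.total.hom]
    (π₁ π₂ : 𝒯.total ⟶ 𝒮.total) [Flat π₁.left] [LocallyOfFinitePresentation π₁.left] [IsFinite π₁.left] [Surjective π₁.left]
    (p₁ p₂ : T ⟶ X)
    (hπ₁ : (genericFibre (valuationSubringAtPrime K v) K).map π₁ ≫ 𝒮.genericIso'.hom = 𝒯.genericIso'.hom ≫ p₁)
    (hπ₂ : (genericFibre (valuationSubringAtPrime K v) K).map π₂ ≫ 𝒮.genericIso'.hom = 𝒯.genericIso'.hom ≫ p₂)
    (s s' : AlgPoints 𝒮.reductionAt (geomResidueField v) → AlgPoints 𝒯.reductionAt (geomResidueField v))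
    (hcov : ∀ (z : AlgPoints 𝒯.reductionAt (geomResidueField v)) (yb : AlgPoints 𝒮.reductionAt (geomResidueField v)),
      AlgPoints.map ((specialFibreFunctor v).map π₁) z = yb → z = s yb ∨ z = s' yb)
    (hs : ∀ yb : AlgPoints 𝒮.reductionAt (geomResidueField v), AlgPoints.map ((specialFibreFunctor v).map π₁) (s yb) = yb)
    (V : (𝒯.reductionAt).left.Opens) [IsOpenImmersion (V.ι ≫ ((specialFibreFunctor v).map π₁).left)]
    (hV : ∀ yb : AlgPoints 𝒮.reductionAt (geomResidueField v),
      s yb ≠ s' yb → (s yb).toSpecHom.base (closedPoint (geomResidueField v)) ∈ V)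
    (x : AlgPoints X (AlgebraicClosure (v.adicCompletion K))) :
    ∑ᶠ y : {y : AlgPoints T (AlgebraicClosure (v.adicCompletion K)) // AlgPoints.map p₁ y = x},
        ({𝒮.geomReductionMap (AlgPoints.map p₂ y.1)} : Multiset (AlgPoints 𝒮.reductionAt (geomResidueField v)))
      = {AlgPoints.map ((specialFibreFunctor v).map π₂) (s (𝒮.geomReductionMap x))}
        + (Nat.card {y : AlgPoints T (AlgebraicClosure (v.adicCompletion K)) // AlgPoints.map p₁ y = x} - 1) •
          ({AlgPoints.map ((specialFibreFunctor v).map π₂) (s' (𝒮.geomReductionMap x))} :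
            Multiset (AlgPoints 𝒮.reductionAt (geomResidueField v))) := by
  haveI := isFinite_of_genericFibre 𝒮 𝒯 π₁ p₁ hπ₁
  haveI := surjective_of_genericFibre 𝒮 𝒯 π₁ p₁ hπ₁
  exact finsum_geomReductionMap_map_eq_of_isOpenImmersion_specialFibre_of_isFinite 𝒮 𝒯 π₁ π₂ p₁ p₂ hπ₁ hπ₂ s s' hcov hs V hV x

/-- **The bridge at a level where `p₁` is finite ÉTALE** (a neat level: the level map `u′` is finite étale): the number of points over `x`
is the degree `p₁.left.finrank` at the point of `x` (★ (Γ3-D) `AlgPoints.card_fibre_eq_finrank_of_isFinite_of_etale`), so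
`Σ_{y over x} {red_𝒮 (p₂ y)} = {π₂ᵥ (s x̄)} + (rank_x p₁ − 1) • {π₂ᵥ (s' x̄)}`.
[cite: SerreTate1968, §1] [cite: GortzWedhorn2020, Prop. 12.21] [cite: Liu2021, proof of Cor. D.9 p. 139 L4–L10] -/
theorem finsum_geomReductionMap_map_eq_of_isOpenImmersion_specialFibre_of_etale
    (𝒮 : IntegralModel (valuationSubringAtPrime K v) K X) (𝒯 : IntegralModel (valuationSubringAtPrime K v) K T)
    [IsProper 𝒮.total.hom] [IsProper 𝒯.total.hom]
    (π₁ π₂ : 𝒯.total ⟶ 𝒮.total) [Flat π₁.left] [LocallyOfFinitePresentation π₁.left] (p₁ p₂ : T ⟶ X)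
    [IsFinite p₁.left] [Etale p₁.left] [Surjective p₁.left]
    (hπ₁ : (genericFibre (valuationSubringAtPrime K v) K).map π₁ ≫ 𝒮.genericIso'.hom = 𝒯.genericIso'.hom ≫ p₁)
    (hπ₂ : (genericFibre (valuationSubringAtPrime K v) K).map π₂ ≫ 𝒮.genericIso'.hom = 𝒯.genericIso'.hom ≫ p₂)
    (s s' : AlgPoints 𝒮.reductionAt (geomResidueField v) → AlgPoints 𝒯.reductionAt (geomResidueField v))
    (hcov : ∀ (z : AlgPoints 𝒯.reductionAt (geomResidueField v)) (yb : AlgPoints 𝒮.reductionAt (geomResidueField v)),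
      AlgPoints.map ((specialFibreFunctor v).map π₁) z = yb → z = s yb ∨ z = s' yb)
    (hs : ∀ yb : AlgPoints 𝒮.reductionAt (geomResidueField v), AlgPoints.map ((specialFibreFunctor v).map π₁) (s yb) = yb)
    (V : (𝒯.reductionAt).left.Opens) [IsOpenImmersion (V.ι ≫ ((specialFibreFunctor v).map π₁).left)]
    (hV : ∀ yb : AlgPoints 𝒮.reductionAt (geomResidueField v),
      s yb ≠ s' yb → (s yb).toSpecHom.base (closedPoint (geomResidueField v)) ∈ V)
    (x : AlgPoints X (AlgebraicClosure (v.adicCompletion K))) :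
    ∑ᶠ y : {y : AlgPoints T (AlgebraicClosure (v.adicCompletion K)) // AlgPoints.map p₁ y = x},
        ({𝒮.geomReductionMap (AlgPoints.map p₂ y.1)} : Multiset (AlgPoints 𝒮.reductionAt (geomResidueField v)))
      = {AlgPoints.map ((specialFibreFunctor v).map π₂) (s (𝒮.geomReductionMap x))}
        + (p₁.left.finrank (x.toSpecHom.base (closedPoint (AlgebraicClosure (v.adicCompletion K)))) - 1) •
          ({AlgPoints.map ((specialFibreFunctor v).map π₂) (s' (𝒮.geomReductionMap x))} :
            Multiset (AlgPoints 𝒮.reductionAt (geomResidueField v))) := by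
  rw [← AlgPoints.card_fibre_eq_finrank_of_isFinite_of_etale p₁ x]
  exact finsum_geomReductionMap_map_eq_of_isOpenImmersion_specialFibre_of_isFinite 𝒮 𝒯 π₁ π₂ p₁ p₂ hπ₁ hπ₂ s s' hcov hs V hV x

/-! ### §5 Pushing a map `Fr` of the special fibre through the identity (the shape the record letter consumes) -/

/-- Pushing a map `Fr` through a finite `∑ᶠ` of singletons equal to `{a} + n • {b}`. [folklore] -/
private theorem finsum_singleton_map_eq {ι β : Type*} [Finite ι] (m : ι → β) (Fr : β → β) {a b a' b' : β} {n : ℕ}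
    (h : ∑ᶠ i, ({m i} : Multiset β) = {a} + n • ({b} : Multiset β)) (ha : Fr a = a') (hb : Fr b = b') :
    ∑ᶠ i, ({Fr (m i)} : Multiset β) = {a'} + n • ({b'} : Multiset β) := by
  subst ha hb
  have hmap : Multiset.map Fr (∑ᶠ i, ({m i} : Multiset β)) = ∑ᶠ i, ({Fr (m i)} : Multiset β) := by
    rw [← Multiset.coe_mapAddMonoidHom, AddMonoidHom.map_finsum _ (Set.toFinite _)]
    simp only [Multiset.coe_mapAddMonoidHom, Multiset.map_singleton]
  rw [← hmap, h, Multiset.map_add, Multiset.map_nsmul, Multiset.map_singleton, Multiset.map_singleton]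

/-- **The bridge with a self-map `Fr` of `𝒮ᵥ(κ̄)` pushed through** (F0P5a-p01 (g3) letter datum): in the situation of
`finsum_geomReductionMap_map_eq_of_isOpenImmersion_specialFibre`, let `Fr` be any self-map of the `κ̄(v)`-points of `𝒮ᵥ` (in [Liu2021] D.8 (3)
the `q`-Frobenius), with `π₂ᵥ ∘ s = Fr` on `κ̄(v)`-points (`hs₂`) and `Fr ∘ π₂ᵥ ∘ s' ∘ red_𝒮 = g` on `X(Ω)` for some function `g` (`hs'₂`; in
D.8 (3) `g = red_𝒮 ∘ ⟨ϖ⟩`).  Then `Σ_{y over x} {Fr (red_𝒮 (p₂ y))} = {Fr (Fr (red_𝒮 x))} + (n − 1) • {g x}` — apply `Multiset.map Fr` to the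
bridge and rewrite the two branch values.  No Frobenius, no translate: `Fr`, `g` are plain functions.
[cite: SerreTate1968, §1] [cite: Liu2021, Prop. D.8 (1)–(3) and proof of Cor. D.9 p. 139 L4–L10] -/
theorem finsum_map_geomReductionMap_map_eq_of_isOpenImmersion_specialFibre
    (𝒮 : IntegralModel (valuationSubringAtPrime K v) K X) (𝒯 : IntegralModel (valuationSubringAtPrime K v) K T)
    [IsProper 𝒮.total.hom] [IsProper 𝒯.total.hom]
    (π₁ π₂ : 𝒯.total ⟶ 𝒮.total) [Flat π₁.left] [LocallyOfFinitePresentation π₁.left] (p₁ p₂ : T ⟶ X)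
    (hπ₁ : (genericFibre (valuationSubringAtPrime K v) K).map π₁ ≫ 𝒮.genericIso'.hom = 𝒯.genericIso'.hom ≫ p₁)
    (hπ₂ : (genericFibre (valuationSubringAtPrime K v) K).map π₂ ≫ 𝒮.genericIso'.hom = 𝒯.genericIso'.hom ≫ p₂)
    (hfin : ∀ x : AlgPoints X (AlgebraicClosure (v.adicCompletion K)),
      Set.Finite {y : AlgPoints T (AlgebraicClosure (v.adicCompletion K)) | AlgPoints.map p₁ y = x})
    (hne : ∀ x : AlgPoints X (AlgebraicClosure (v.adicCompletion K)),
      ∃ y : AlgPoints T (AlgebraicClosure (v.adicCompletion K)), AlgPoints.map p₁ y = x)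
    (s s' : AlgPoints 𝒮.reductionAt (geomResidueField v) → AlgPoints 𝒯.reductionAt (geomResidueField v))
    (hcov : ∀ (z : AlgPoints 𝒯.reductionAt (geomResidueField v)) (yb : AlgPoints 𝒮.reductionAt (geomResidueField v)),
      AlgPoints.map ((specialFibreFunctor v).map π₁) z = yb → z = s yb ∨ z = s' yb)
    (hs : ∀ yb : AlgPoints 𝒮.reductionAt (geomResidueField v), AlgPoints.map ((specialFibreFunctor v).map π₁) (s yb) = yb)
    (V : (𝒯.reductionAt).left.Opens) [IsOpenImmersion (V.ι ≫ ((specialFibreFunctor v).map π₁).left)]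
    (hV : ∀ yb : AlgPoints 𝒮.reductionAt (geomResidueField v),
      s yb ≠ s' yb → (s yb).toSpecHom.base (closedPoint (geomResidueField v)) ∈ V)
    (Fr : AlgPoints 𝒮.reductionAt (geomResidueField v) → AlgPoints 𝒮.reductionAt (geomResidueField v))
    (hs₂ : ∀ yb : AlgPoints 𝒮.reductionAt (geomResidueField v), AlgPoints.map ((specialFibreFunctor v).map π₂) (s yb) = Fr yb)
    (g : AlgPoints X (AlgebraicClosure (v.adicCompletion K)) → AlgPoints 𝒮.reductionAt (geomResidueField v))
    (hs'₂ : ∀ y : AlgPoints X (AlgebraicClosure (v.adicCompletion K)),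
      Fr (AlgPoints.map ((specialFibreFunctor v).map π₂) (s' (𝒮.geomReductionMap y))) = g y)
    (x : AlgPoints X (AlgebraicClosure (v.adicCompletion K))) :
    ∑ᶠ y : {y : AlgPoints T (AlgebraicClosure (v.adicCompletion K)) // AlgPoints.map p₁ y = x},
        ({Fr (𝒮.geomReductionMap (AlgPoints.map p₂ y.1))} : Multiset (AlgPoints 𝒮.reductionAt (geomResidueField v)))
      = {Fr (Fr (𝒮.geomReductionMap x))}
        + (Nat.card {y : AlgPoints T (AlgebraicClosure (v.adicCompletion K)) // AlgPoints.map p₁ y = x} - 1) •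
          ({g x} : Multiset (AlgPoints 𝒮.reductionAt (geomResidueField v))) := by
  haveI : Finite {y : AlgPoints T (AlgebraicClosure (v.adicCompletion K)) // AlgPoints.map p₁ y = x} := (hfin x).to_subtype
  exact finsum_singleton_map_eq _ Fr
    (finsum_geomReductionMap_map_eq_of_isOpenImmersion_specialFibre 𝒮 𝒯 π₁ π₂ p₁ p₂ hπ₁ hπ₂ hfin hne s s' hcov hs V hV x)
    (congrArg Fr (hs₂ _)) (hs'₂ x)

end IntegralModel

end Literature.AlgebraicGeometry.Motives

end
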